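import Literature.NumberTheory.Automorphic.ClassFieldCharacter
import Literature.NumberTheory.Automorphic.PairLFunctionBaseChange
import Literature.NumberTheory.GaloisRepresentations.HeckeCharacterProofs
import HarnessLib

/-!
# Local norms at a finite place lie in the norm group: `χ_v^{e_v f_v} = 1` (proof file)

Topic `NumberTheory/Automorphic`; namespaces `Literature.Automorphic`, `Literature.NumberTheory.GaloisRepresentations.HeckeCharacter`. Sibling proof
file of `ClassFieldCharacter` (the Galois norm `N y = ∏_σ σ • y` on `𝔸_Eˣ`, the group of norms
`idelicNormSubgroup F E = {x ∈ 𝔸_Fˣ : x_E ∈ N(𝔸_Eˣ)}`, the norm group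
`normGroup F E = F^× N(𝔸_E^×)`, `IsTrivialOnNormGroup`, `IsClassFieldCharacter`). Everything here
is **proved**:

* `Literature.NumberTheory.Automorphic.ideleBaseChange_localUnits` — the base change `𝔸_Fˣ → 𝔸_Eˣ` of the local idele
  `⟨u⟩_v` (`u ∈ F_vˣ` at `v`, `1` elsewhere) is `∏_{w ∣ v} ⟨u⟩_w` (`u` viewed in `E_w ⊇ F_v`).
* `Literature.NumberTheory.Automorphic.smul_localUnits` — `σ • ⟨c⟩_w = ⟨σ c⟩_{σ w}` for `σ ∈ Aut(E/F)`.
* `Literature.NumberTheory.Automorphic.ideleGalNorm_localUnits` — for `E/F` Galois and `w₀ ∣ v`: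
  `N(⟨u⟩_{w₀}) = (∏_{w ∣ v} ⟨u⟩_w)^{#D_{w₀}} = ((⟨u⟩_v)_E)^{e_v f_v}`, where `#D_{w₀} = e_v f_v` is the
  order of the decomposition group (orbit–stabiliser with `#{w ∣ v} e_v f_v = [E : F]`, Mathlib
  `Ideal.ncard_primesOver_mul_ramificationIdxIn_mul_inertiaDegIn`).
* `Literature.NumberTheory.Automorphic.localUnits_pow_mem_idelicNormSubgroup` — hence **`⟨u⟩_v^{e_v f_v} ∈ N(𝔸_Eˣ)`**
  for every finite place `v` of `F` and `u ∈ F_vˣ`: the global shadow, inside the idelic norm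
  group of this file's sibling, of the local fact `N_{E_w/F_v}(u) = u^{[E_w : F_v]}`
  (Cassels–Fröhlich, Ch. VII §6 with Ch. II §11: local norms embed in the idele norm group).
* Consequences for a Hecke character `χ` of `F` trivial on `F^× N(𝔸_E^×)` — in particular for the
  class-field character `η` of Arthur–Clozel, Ch. 3 §4:
  `IsTrivialOnNormGroup.apply_localUnits_pow` (`χ(⟨u⟩_v)^{e_v f_v} = 1`),
  `IsTrivialOnNormGroup.valueAtUniformizer_pow` (**`χ(ϖ_v)` is an `e_v f_v`-th root of unity**; at an
  unramified place an `f_v`-th root of unity, the elementary half of "`η(ϖ_v)` is a primitive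
  `f_v`-th root of unity", Arthur–Clozel, Ch. 3, p. 172, which class field theory completes),
  `IsTrivialOnNormGroup.apply_localUnits_eq_one_of_split` (**`χ_v = 1` at a place split completely
  in `E`**), and the `IsClassFieldCharacter` specialisations.

## References

* J. W. S. Cassels, A. Fröhlich (eds.), *Algebraic Number Theory* (1967), Ch. II (Cassels) §11
  (local norms, `[L_w : K_v] = e f`), Ch. VII (Tate) §1.1–§1.2 (action of `G` on places and
  completions, decomposition group), §4.4, §6. [CasselsFrohlichANT1967]
* J. Arthur, L. Clozel, *Simple algebras, base change, and the advanced theory of the trace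
  formula*, Ann. of Math. Stud. 120 (1989), Ch. 3, p. 172 and §4 (the character `η`).
  [ArthurClozelAMS120]
-/

noncomputable section

open NumberField IsDedekindDomain

namespace Literature.NumberTheory.Automorphic

section LocalNorms

variable (F E : Type) [Field F] [Field E] [Algebra F E] [NumberField F] [NumberField E]

/-- `finiteAdeleSingle` of `HeckeCharacter` is `FiniteAdeleRing.mulSingle` of
`GaloisActionAdeleRing` (both are Mathlib's `RestrictedProduct.mulSingle`). [folklore] -/
theorem finiteAdeleSingle_eq_mulSingle [DecidableEq (HeightOneSpectrum (𝓞 E))]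
    (w : HeightOneSpectrum (𝓞 E)) (y : w.adicCompletion E) :
    Literature.NumberTheory.GaloisRepresentations.finiteAdeleSingle w y = FiniteAdeleRing.mulSingle (L := E) w y := by
  refine FiniteAdeleRing.ext E fun u => ?_
  by_cases hu : u = w
  · subst hu
    rw [Literature.NumberTheory.GaloisRepresentations.finiteAdeleSingle_apply_self, FiniteAdeleRing.mulSingle_apply_self]
  · rw [Literature.NumberTheory.GaloisRepresentations.finiteAdeleSingle_apply_of_ne _ hu, FiniteAdeleRing.mulSingle_apply_of_ne E _ hu]

omit [NumberField F] in
/-- **`Aut(E/F)` permutes the local ideles**: `σ • ⟨c⟩_w = ⟨σ c⟩_{σ w}` for `c ∈ E_wˣ`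
(Cassels–Fröhlich, Ch. VII §1.1: `σ` induces `L_w ≅ L_{σ w}`). [cite: CasselsFrohlichANT1967, Ch. VII §1.1] -/
theorem smul_localUnits (σ : E ≃ₐ[F] E) (w : HeightOneSpectrum (𝓞 E)) (c : (w.adicCompletion E)ˣ) :
    σ • Literature.NumberTheory.GaloisRepresentations.localUnits w c =
      Literature.NumberTheory.GaloisRepresentations.localUnits (σ • w) (galAdicCompletionUnitsEquiv (L := E) σ rfl c) := by
  classical
  refine Units.ext (Prod.ext ?_ ?_)
  · rw [AdeleRing.coe_smul_units, AdeleRing.smul_fst, Literature.NumberTheory.GaloisRepresentations.localUnits_fst, Literature.NumberTheory.GaloisRepresentations.localUnits_fst, smul_one]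
  · rw [AdeleRing.coe_smul_units, AdeleRing.smul_snd]
    change σ • Literature.NumberTheory.GaloisRepresentations.finiteAdeleSingle w (c : w.adicCompletion E) =
      Literature.NumberTheory.GaloisRepresentations.finiteAdeleSingle (σ • w) ((galAdicCompletionUnitsEquiv (L := E) σ rfl c : ((σ • w).adicCompletion E)ˣ) : (σ • w).adicCompletion E)
    rw [finiteAdeleSingle_eq_mulSingle, finiteAdeleSingle_eq_mulSingle, FiniteAdeleRing.smul_mulSingle]
    rfl

variable {F} in
/-- The local units of `E` above `v` attached to `u ∈ F_vˣ`: `u` viewed in `E_wˣ` for `w ∣ v`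
(through `F_v → E_w`, `adicCompletionOfLiesOver`, for any `LiesOver` witness), and `1` at the places
not above `v` (auxiliary family for `ideleBaseChange_localUnits`). [folklore] -/
theorem exists_localUnitsAbove (v : HeightOneSpectrum (𝓞 F)) (u : (v.adicCompletion F)ˣ) :
    ∃ c : ∀ w : HeightOneSpectrum (𝓞 E), (w.adicCompletion E)ˣ,
      (∀ (w : HeightOneSpectrum (𝓞 E)) (_ : w.under (𝓞 F) = v) [w.asIdeal.LiesOver v.asIdeal],
        (c w : w.adicCompletion E) = adicCompletionOfLiesOver F E v w (u : v.adicCompletion F)) ∧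
      ∀ w : HeightOneSpectrum (𝓞 E), w.under (𝓞 F) ≠ v → c w = 1 := by
  classical
  refine ⟨fun w => if h : w.under (𝓞 F) = v then
      Units.map (@adicCompletionOfLiesOver (𝓞 F) F E (𝓞 E) _ _ _ _ _ _ _ _ _ _ _ _ _ _ _ _ v w
        ⟨(congrArg HeightOneSpectrum.asIdeal h).symm⟩).toMonoidHom u else 1, ?_, ?_⟩
  · intro w h _
    simp only [dif_pos h]
    rfl
  · intro w h
    simp only [dif_neg h]

variable {F} in
/-- **Base change of a local idele**: the image in `𝔸_Eˣ` of `⟨u⟩_v` (`u ∈ F_vˣ` at `v`, `1`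
elsewhere) is `∏_{w ∣ v} ⟨u⟩_w`, `u` being viewed in each `E_w ⊇ F_v` (components: `(x_E)_w = x_{w|_F}`;
Cassels–Fröhlich, Ch. II §14 and Ch. VII §4.3, "compatibility of ideal and idèle norms" side
computations). Here `T` is any finset listing the places above `v`. [folklore] -/
theorem ideleBaseChange_localUnits (v : HeightOneSpectrum (𝓞 F)) (u : (v.adicCompletion F)ˣ)
    (c : ∀ w : HeightOneSpectrum (𝓞 E), (w.adicCompletion E)ˣ)
    (hc : ∀ (w : HeightOneSpectrum (𝓞 E)) (_ : w.under (𝓞 F) = v) [w.asIdeal.LiesOver v.asIdeal],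
      (c w : w.adicCompletion E) = adicCompletionOfLiesOver F E v w (u : v.adicCompletion F))
    (T : Finset (HeightOneSpectrum (𝓞 E))) (hT : ∀ w, w ∈ T ↔ w.under (𝓞 F) = v) :
    AdeleRing.ideleBaseChange F E (Literature.NumberTheory.GaloisRepresentations.localUnits v u) = ∏ w ∈ T, Literature.NumberTheory.GaloisRepresentations.localUnits w (c w) := by
  classical
  refine Units.ext (Prod.ext ?_ ?_)
  · rw [AdeleRing.coe_ideleBaseChange, AdeleRing.baseChange_fst, Literature.NumberTheory.GaloisRepresentations.localUnits_fst, map_one,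
      Literature.NumberTheory.GaloisRepresentations.fst_prod_localUnits]
  · rw [AdeleRing.coe_ideleBaseChange, AdeleRing.baseChange_snd]
    refine FiniteAdeleRing.ext E fun w => ?_
    rw [FiniteAdeleRing.baseChange_apply, Literature.NumberTheory.GaloisRepresentations.snd_prod_localUnits]
    by_cases hw : w.under (𝓞 F) = v
    · haveI : w.asIdeal.LiesOver v.asIdeal := ⟨(congrArg HeightOneSpectrum.asIdeal hw).symm⟩
      rw [if_pos ((hT w).2 hw), hc w hw,
        adicCompletionOfUnder_eq F w hw
          (fun p => ((Literature.NumberTheory.GaloisRepresentations.localUnits v u : (AdeleRing (𝓞 F) F)ˣ) : AdeleRing (𝓞 F) F).2 p),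
        Literature.NumberTheory.GaloisRepresentations.localUnits_snd_apply_self]
    · rw [if_neg (fun h => hw ((hT w).1 h)), Literature.NumberTheory.GaloisRepresentations.localUnits_snd_apply_of_ne _ hw, map_one]

/-- The places of `E` above `v = w₀|_F` are the `Aut(E/F)`-conjugates of `w₀` (`E/F` Galois;
transitivity, Cassels–Fröhlich, Ch. VII, Prop. 1.2 (ii)). [cite: CasselsFrohlichANT1967, Ch. VII Prop. 1.2 (ii)] -/
theorem HeightOneSpectrum.mem_image_algEquiv_smul_iff [IsGalois F E] [DecidableEq (HeightOneSpectrum (𝓞 E))]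
    (w₀ w : HeightOneSpectrum (𝓞 E)) :
    w ∈ Finset.univ.image (fun σ : E ≃ₐ[F] E => σ • w₀) ↔ w.under (𝓞 F) = w₀.under (𝓞 F) := by
  rw [Finset.mem_image]
  constructor
  · rintro ⟨σ, -, rfl⟩
    exact HeightOneSpectrum.under_algEquiv_smul (F := F) (E := E) σ w₀
  · intro h
    obtain ⟨σ, hσ⟩ := HeightOneSpectrum.exists_algEquiv_smul_eq (F := F) h.symm
    exact ⟨σ, Finset.mem_univ _, hσ⟩

/-- The fibres of `σ ↦ σ • w₀` all have `#Stab(w₀)` elements (cosets of the decomposition group).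
[folklore] -/
theorem card_filter_algEquiv_smul_eq [DecidableEq (HeightOneSpectrum (𝓞 E))] (w₀ : HeightOneSpectrum (𝓞 E))
    (τ : E ≃ₐ[F] E) :
    (Finset.univ.filter fun σ : E ≃ₐ[F] E => σ • w₀ = τ • w₀).card =
      Nat.card (MulAction.stabilizer (E ≃ₐ[F] E) w₀) := by
  classical
  rw [Nat.card_eq_fintype_card, Fintype.card_subtype]
  have himage : (Finset.univ.filter fun σ : E ≃ₐ[F] E => σ • w₀ = τ • w₀) =
      (Finset.univ.filter fun σ : E ≃ₐ[F] E => σ ∈ MulAction.stabilizer (E ≃ₐ[F] E) w₀).image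
        (τ * ·) := by
    ext σ
    simp only [Finset.mem_filter, Finset.mem_univ, true_and, Finset.mem_image,
      MulAction.mem_stabilizer_iff]
    constructor
    · intro h
      refine ⟨τ⁻¹ * σ, ?_, by rw [mul_inv_cancel_left]⟩
      rw [mul_smul, h, inv_smul_smul]
    · rintro ⟨s, hs, rfl⟩
      rw [mul_smul, hs]
  rw [himage, Finset.card_image_of_injective _ (mul_right_injective τ)]

/-- **The decomposition group has order `e_v f_v`**: for `E/F` Galois and `w₀ ∣ v`,
`#Stab(w₀) = e_v f_v` (orbit–stabiliser, the orbit of `w₀` being the `#{w ∣ v}` places above `v`,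
and `#{w ∣ v} · e_v f_v = [E : F]`, Mathlib `Ideal.ncard_primesOver_mul_ramificationIdxIn_mul_inertiaDegIn`).
Cassels–Fröhlich, Ch. VII §1.2 (`[L_w : K_v] = #G_w`) with Ch. II §11. [cite: CasselsFrohlichANT1967, Ch. VII §1.2] -/
theorem HeightOneSpectrum.card_stabilizer_algEquiv [IsGalois F E] (w₀ : HeightOneSpectrum (𝓞 E)) :
    Nat.card (MulAction.stabilizer (E ≃ₐ[F] E) w₀) =
      (w₀.under (𝓞 F)).asIdeal.ramificationIdxIn (𝓞 E) * (w₀.under (𝓞 F)).asIdeal.inertiaDegIn (𝓞 E) := by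
  classical
  set v := w₀.under (𝓞 F) with hv
  have h1 := (MulAction.stabilizer (E ≃ₐ[F] E) w₀).index_mul_card
  have h2 : (MulAction.stabilizer (E ≃ₐ[F] E) w₀).index = (v.asIdeal.primesOver (𝓞 E)).ncard := by
    rw [MulAction.index_stabilizer, ← card_placesOver (F := F) (E := E) v, ← Nat.card_coe_set_eq]
    refine Nat.card_congr (Equiv.subtypeEquivRight fun w => ?_)
    rw [MulAction.mem_orbit_iff]
    constructor
    · rintro ⟨σ, rfl⟩
      exact HeightOneSpectrum.under_algEquiv_smul (F := F) (E := E) σ w₀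
    · intro h
      exact HeightOneSpectrum.exists_algEquiv_smul_eq (F := F) (Eq.symm h)
  have h3 := Ideal.ncard_primesOver_mul_ramificationIdxIn_mul_inertiaDegIn v.asIdeal (𝓞 E) (E ≃ₐ[F] E)
  rw [h2] at h1
  rw [← h1] at h3
  have hpos : (v.asIdeal.primesOver (𝓞 E)).ncard ≠ 0 := by
    intro h0
    rw [h0, zero_mul] at h1
    exact Nat.card_pos.ne' h1.symm
  exact (Nat.eq_of_mul_eq_mul_left (Nat.pos_of_ne_zero hpos) h3).symm

variable {F} in
/-- **The Galois norm of a local idele above `v`**: for `E/F` Galois, `w₀ ∣ v` and `u ∈ F_vˣ`,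
`N(⟨u⟩_{w₀}) = ∏_σ ⟨u⟩_{σ w₀} = ((⟨u⟩_v)_E)^{e_v f_v}` (each place above `v` is hit `#Stab(w₀) = e_v f_v`
times). This is the idelic form of the local computation `N_{E_w/F_v}(u) = u^{[E_w : F_v]}` for
`u ∈ F_v` (Cassels–Fröhlich, Ch. II §11, Ch. VII §1.2). [cite: CasselsFrohlichANT1967, Ch. VII §1.2] -/
theorem ideleGalNorm_localUnits [IsGalois F E] (v : HeightOneSpectrum (𝓞 F)) (u : (v.adicCompletion F)ˣ)
    (c : ∀ w : HeightOneSpectrum (𝓞 E), (w.adicCompletion E)ˣ)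
    (hc : ∀ (w : HeightOneSpectrum (𝓞 E)) (_ : w.under (𝓞 F) = v) [w.asIdeal.LiesOver v.asIdeal],
      (c w : w.adicCompletion E) = adicCompletionOfLiesOver F E v w (u : v.adicCompletion F))
    {w₀ : HeightOneSpectrum (𝓞 E)} (hw₀ : w₀.under (𝓞 F) = v) :
    AdeleRing.ideleGalNorm F E (Literature.NumberTheory.GaloisRepresentations.localUnits w₀ (c w₀)) =
      AdeleRing.ideleBaseChange F E (Literature.NumberTheory.GaloisRepresentations.localUnits v u) ^
        (v.asIdeal.ramificationIdxIn (𝓞 E) * v.asIdeal.inertiaDegIn (𝓞 E)) := by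
  classical
  -- `σ • ⟨c_{w₀}⟩ = ⟨c_{σ w₀}⟩`
  have hsmul : ∀ σ : E ≃ₐ[F] E, σ • Literature.NumberTheory.GaloisRepresentations.localUnits w₀ (c w₀) = Literature.NumberTheory.GaloisRepresentations.localUnits (σ • w₀) (c (σ • w₀)) := by
    intro σ
    rw [smul_localUnits]
    congr 1
    refine Units.ext ?_
    haveI : w₀.asIdeal.LiesOver v.asIdeal := ⟨(congrArg HeightOneSpectrum.asIdeal hw₀).symm⟩
    have hσ : (σ • w₀).under (𝓞 F) = v := by
      rw [HeightOneSpectrum.under_algEquiv_smul (F := F) (E := E) σ w₀, hw₀]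
    haveI : (σ • w₀).asIdeal.LiesOver v.asIdeal := ⟨(congrArg HeightOneSpectrum.asIdeal hσ).symm⟩
    change galAdicCompletionMap σ rfl (c w₀ : w₀.adicCompletion E) = (c (σ • w₀) : (σ • w₀).adicCompletion E)
    rw [hc w₀ hw₀, hc (σ • w₀) hσ, galAdicCompletionMap_adicCompletionOfLiesOver F σ v rfl]
  -- regroup `∏_σ` along the fibres of `σ ↦ σ • w₀`
  set T : Finset (HeightOneSpectrum (𝓞 E)) := Finset.univ.image (fun σ : E ≃ₐ[F] E => σ • w₀) with hTdef
  have hT : ∀ w, w ∈ T ↔ w.under (𝓞 F) = v := fun w => by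
    rw [hTdef, HeightOneSpectrum.mem_image_algEquiv_smul_iff, hw₀]
  rw [AdeleRing.ideleGalNorm_apply]
  simp_rw [hsmul]
  rw [Finset.prod_comp (fun w => Literature.NumberTheory.GaloisRepresentations.localUnits w (c w)) (fun σ : E ≃ₐ[F] E => σ • w₀)]
  have hfib : ∀ w ∈ T, (Finset.univ.filter fun σ : E ≃ₐ[F] E => σ • w₀ = w).card =
      v.asIdeal.ramificationIdxIn (𝓞 E) * v.asIdeal.inertiaDegIn (𝓞 E) := by
    intro w hw
    obtain ⟨τ, -, rfl⟩ := Finset.mem_image.1 hw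
    have h := card_filter_algEquiv_smul_eq (F := F) E w₀ τ
    rw [HeightOneSpectrum.card_stabilizer_algEquiv, hw₀] at h
    convert h using 2
  rw [Finset.prod_congr rfl fun w hw => by rw [hfib w hw], Finset.prod_pow,
    ideleBaseChange_localUnits E v u c hc T hT]

variable {F} in
/-- **Local norms lie in the group of norms: `⟨u⟩_v^{e_v f_v} ∈ N(𝔸_Eˣ)`** for `E/F` Galois, every
finite place `v` of `F` and `u ∈ F_vˣ` (`= N(⟨u⟩_{w₀})` for any `w₀ ∣ v`, `ideleGalNorm_localUnits`).
Cassels–Fröhlich, Ch. VII §6 (local norms and the norm residue symbol): `N_{E_w/F_v}(u) = u^{e f}`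
for `u ∈ F_v`. [cite: CasselsFrohlichANT1967, Ch. VII §1.2] -/
theorem localUnits_pow_mem_idelicNormSubgroup [IsGalois F E] (v : HeightOneSpectrum (𝓞 F))
    (u : (v.adicCompletion F)ˣ) :
    Literature.NumberTheory.GaloisRepresentations.localUnits v u ^ (v.asIdeal.ramificationIdxIn (𝓞 E) * v.asIdeal.inertiaDegIn (𝓞 E)) ∈
      idelicNormSubgroup F E := by
  obtain ⟨w₀, hw₀⟩ := HeightOneSpectrum.under_surjective (A := 𝓞 F) (B := 𝓞 E) v
  obtain ⟨c, hc, -⟩ := exists_localUnitsAbove E v u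
  exact ⟨Literature.NumberTheory.GaloisRepresentations.localUnits w₀ (c w₀), by rw [map_pow, ideleGalNorm_localUnits E v u c hc hw₀]⟩

variable {F} in
/-- `⟨u⟩_v^{e_v f_v} ∈ F^× N(𝔸_E^×)`. [folklore] -/
theorem localUnits_pow_mem_normGroup [IsGalois F E] (v : HeightOneSpectrum (𝓞 F))
    (u : (v.adicCompletion F)ˣ) :
    Literature.NumberTheory.GaloisRepresentations.localUnits v u ^ (v.asIdeal.ramificationIdxIn (𝓞 E) * v.asIdeal.inertiaDegIn (𝓞 E)) ∈
      normGroup F E :=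
  idelicNormSubgroup_le_normGroup F E (localUnits_pow_mem_idelicNormSubgroup E v u)

end LocalNorms

/-! ### Consequences for characters of `𝔸_F^× / F^× N(𝔸_E^×)` -/

section Characters

variable {F : Type} (E : Type) [Field F] [Field E] [Algebra F E] [NumberField F] [NumberField E]
  [IsGalois F E]

/-- **`χ(⟨u⟩_v)^{e_v f_v} = 1`** for a Hecke character `χ` of `F` trivial on `F^× N(𝔸_E^×)`, every
finite `v` and `u ∈ F_vˣ` (`localUnits_pow_mem_normGroup`). [folklore] -/
theorem _root_.Literature.NumberTheory.GaloisRepresentations.HeckeCharacter.IsTrivialOnNormGroup.apply_localUnits_pow {χ : Literature.NumberTheory.GaloisRepresentations.HeckeCharacter F}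
    (hχ : χ.IsTrivialOnNormGroup E) (v : HeightOneSpectrum (𝓞 F)) (u : (v.adicCompletion F)ˣ) :
    χ (Literature.NumberTheory.GaloisRepresentations.localUnits v u) ^ (v.asIdeal.ramificationIdxIn (𝓞 E) * v.asIdeal.inertiaDegIn (𝓞 E)) = 1 := by
  rw [← map_pow]
  exact hχ _ (localUnits_pow_mem_normGroup E v u)

/-- **`χ(ϖ_v)` is an `e_v f_v`-th root of unity** for `χ` trivial on `F^× N(𝔸_E^×)` (so an `f_v`-th
root of unity at a place unramified in `E`): the elementary half of "`η(ϖ_v)` is a root of unity of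
order `f_v`" for the class-field character `η` (Arthur–Clozel, Ch. 3, p. 172), whose other half
(the order is *exactly* `f_v`) is class field theory. [cite: ArthurClozelAMS120, Ch. 3, proof of Thm. 3.1 (p. 172)] -/
theorem _root_.Literature.NumberTheory.GaloisRepresentations.HeckeCharacter.IsTrivialOnNormGroup.valueAtUniformizer_pow {χ : Literature.NumberTheory.GaloisRepresentations.HeckeCharacter F}
    (hχ : χ.IsTrivialOnNormGroup E) (v : HeightOneSpectrum (𝓞 F)) :
    χ.valueAtUniformizer v ^ (v.asIdeal.ramificationIdxIn (𝓞 E) * v.asIdeal.inertiaDegIn (𝓞 E)) = 1 := by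
  rw [Literature.NumberTheory.GaloisRepresentations.HeckeCharacter.valueAtUniformizer, Literature.NumberTheory.GaloisRepresentations.HeckeCharacter.localComponent_apply,
    ← Units.val_pow_eq_pow_val, hχ.apply_localUnits_pow E v, Units.val_one]

/-- At a place unramified in `E`, `χ(ϖ_v)^{f_v} = 1`. [folklore] -/
theorem _root_.Literature.NumberTheory.GaloisRepresentations.HeckeCharacter.IsTrivialOnNormGroup.valueAtUniformizer_pow_inertiaDegIn
    {χ : Literature.NumberTheory.GaloisRepresentations.HeckeCharacter F} (hχ : χ.IsTrivialOnNormGroup E) (v : HeightOneSpectrum (𝓞 F))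
    (hv : v.asIdeal.ramificationIdxIn (𝓞 E) = 1) :
    χ.valueAtUniformizer v ^ v.asIdeal.inertiaDegIn (𝓞 E) = 1 := by
  simpa [hv] using hχ.valueAtUniformizer_pow E v

/-- **`χ_v = 1` at a place split completely in `E`** (`e_v f_v = 1`): every `u ∈ F_vˣ` is then a
norm from `E_w = F_v`. [folklore] -/
theorem _root_.Literature.NumberTheory.GaloisRepresentations.HeckeCharacter.IsTrivialOnNormGroup.apply_localUnits_eq_one_of_split
    {χ : Literature.NumberTheory.GaloisRepresentations.HeckeCharacter F} (hχ : χ.IsTrivialOnNormGroup E) (v : HeightOneSpectrum (𝓞 F))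
    (hv : v.asIdeal.ramificationIdxIn (𝓞 E) * v.asIdeal.inertiaDegIn (𝓞 E) = 1)
    (u : (v.adicCompletion F)ˣ) : χ (Literature.NumberTheory.GaloisRepresentations.localUnits v u) = 1 := by
  simpa [hv] using hχ.apply_localUnits_pow E v u

/-- A character trivial on `F^× N(𝔸_E^×)` is unramified at every place split completely in `E`.
[folklore] -/
theorem _root_.Literature.NumberTheory.GaloisRepresentations.HeckeCharacter.IsTrivialOnNormGroup.isUnramifiedAt_of_split
    {χ : Literature.NumberTheory.GaloisRepresentations.HeckeCharacter F} (hχ : χ.IsTrivialOnNormGroup E) (v : HeightOneSpectrum (𝓞 F))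
    (hv : v.asIdeal.ramificationIdxIn (𝓞 E) * v.asIdeal.inertiaDegIn (𝓞 E) = 1) :
    χ.IsUnramifiedAt v := fun u => by
  rw [Literature.NumberTheory.GaloisRepresentations.HeckeCharacter.localComponent_apply]
  exact hχ.apply_localUnits_eq_one_of_split E v hv _

/-- For the class-field character `η` of `E/F` (Arthur–Clozel, Ch. 3 §4), `η(ϖ_v)^{e_v f_v} = 1` at
every finite place `v`. [cite: ArthurClozelAMS120, Ch. 3, proof of Thm. 3.1 (p. 172)] -/
theorem _root_.Literature.NumberTheory.GaloisRepresentations.HeckeCharacter.IsClassFieldCharacter.valueAtUniformizer_pow {η : Literature.NumberTheory.GaloisRepresentations.HeckeCharacter F}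
    (hη : η.IsClassFieldCharacter E) (v : HeightOneSpectrum (𝓞 F)) :
    η.valueAtUniformizer v ^ (v.asIdeal.ramificationIdxIn (𝓞 E) * v.asIdeal.inertiaDegIn (𝓞 E)) = 1 :=
  hη.isTrivialOnNormGroup.valueAtUniformizer_pow E v

/-- The class-field character is trivial on `F_vˣ` at every place `v` split completely in `E`.
[folklore] -/
theorem _root_.Literature.NumberTheory.GaloisRepresentations.HeckeCharacter.IsClassFieldCharacter.apply_localUnits_eq_one_of_split
    {η : Literature.NumberTheory.GaloisRepresentations.HeckeCharacter F} (hη : η.IsClassFieldCharacter E) (v : HeightOneSpectrum (𝓞 F))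
    (hv : v.asIdeal.ramificationIdxIn (𝓞 E) * v.asIdeal.inertiaDegIn (𝓞 E) = 1)
    (u : (v.adicCompletion F)ˣ) : η (Literature.NumberTheory.GaloisRepresentations.localUnits v u) = 1 :=
  hη.isTrivialOnNormGroup.apply_localUnits_eq_one_of_split E v hv u

end Characters

end Literature.NumberTheory.Automorphic
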